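import Literature.NumberTheory.EllipticCurves.Kato2004.DivisibilityInputsSplitTwistDescent
import Literature.NumberTheory.EllipticCurves.Kato2004.DivisibilityInputsExceptionalTransportProofs
import HarnessLib

/-!
# Kato 2004 §17.13 on the ODD branch of the split-multiplicative twist at `2`: from a
# `SplitTwistDivisibilityInputsDescent` package, `X(W/ℚ_∞)` is torsion and `ℓ_𝔮(X(W/ℚ_∞)) ≤ ℓ_𝔮(Λ/(L̃))` OFF the
# exceptional element `θ`; AT `(θ)` by transport (Greenberg's `ι(char X) = char X` + the functional equation
# `(ι L̃) = (L̃)`) — PROVED module theory (companion of `DivisibilityInputsSplitTwistDescent`)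

K. Kato, Astérisque **295** (2004) [Kato2004Asterisque], Thm. 12.5 (3) with (12.5.1) (p. 222), §17.13 (pp. 279–280).
Cell `bsd-2adic`, seat `bsd-2adic-addL2x` GEN 17 (crux stmt-BirchSwinnertonDyer-19098, child C4″ 22618: the
split-twist sub-blocks of the additive census at `2`). THEOREMS ONLY (no definition, no named fact, no instance,
no `sorry`); `Kato2004.thm12_4` and, in the last theorem, the two CONSTRUCTION facts `nonempty_iwasawaH1Data` /
`exists_splitTwistDivisibilityInputsDescent_negOne_two` are hypotheses BY NAME. The proofs are those of
`DivisibilityInputsContraExceptionalTransportProofs` (key-`γ⁻¹` datum, seat addL2x GEN 16) with the injective Coleman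
map replaced by the odd descended one, whose kernel is killed by `2θ` (`SplitTwistDivisibilityInputsDescent.col_ker`):
the §17.13 skeleton is run PRIME BY PRIME with the joint defect constant `c = 2θ·p^a`, admissible at every height-one
`𝔮 ∌ p` with `θ ∉ 𝔮` (`Kato2004.lengthAt_add_le_of_skeleton_exceptional_kerUpTo`; the local term of Thm. 12.5 (3)
cancels against `upTo_H2loc` wherever it sits).

* `two_mul_mul_natCast_pow_ne_zero_and_not_mem` — the defect constant `2θ·p^a ∉ 𝔮` for `θ ∉ 𝔮`.
* `SplitTwistDivisibilityInputsDescent.isTorsion_X` — `X(W/ℚ_∞)` is `Λ`-torsion (Thm. 17.4 (1) shape).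
* `SplitTwistDivisibilityInputsDescent.lengthAt_X_le_off_theta` — **`ℓ_𝔮(X) ≤ ℓ_𝔮(Λ/(L̃))` at every height-one
  `𝔮 ∌ p` with `θ ∉ 𝔮`**, for any integral `L̃ ≠ 0` with `ι L̃ = p^m·L`.
* `….lengthAt_X_le_at_theta_of_transport` / `….lengthAt_X_le_at_theta_of_lengthAt_symm` — the same AT a height-one
  `𝔮₀` with `θ ∉ ι𝔮₀` (e.g. `𝔮₀ = (θ) = (5T + 4)`, `ι(θ) ≐ T − 4`), given `ι(char X) = char X` (ideal form, Greenberg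
  LNM 1716 Thm. 1.14) resp. `ℓ_{𝔮₀}(X) = ℓ_{ι𝔮₀}(X)` (length form), and `(ι L̃) = (L̃)` (functional equation).
* `lengthAt_X_le_off_theta_of_splitTwistDescentFacts_two` — the off-`θ` bound at `p = 2` straight from the three
  facts (`θ = 5T + 4`, `L = padicLFunctionMinusBranchMult f′ 1 1`).

Together: Conj. 17.6's INEQUALITY for the ADDITIVE curve `W` at `2` at every height-one `𝔮 ∌ 2` (off `(5T + 4)` from
the package, at it by transport) — the END statements which the cell's Summits-side doors
(`Theorems/ByReductionTypeAtTwoAdditiveKatoTransportPrintExactAnyImageDoors.lean` and its successors) so far drew from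
the `@[conjecture]` constant `AddKatoTwo.KatoOddBranchInputsAtTwoNegOneSplitTwistPrintExactAnyImage`. Nothing about any
curve is asserted here; BSD is not proved by any of this; nothing is booked.

References: [Kato2004Asterisque] Thm. 12.4 (2) (p. 221), Thm. 12.5 (3) and (12.5.1) (p. 222), Conj. 17.6 (p. 274),
Thm. 17.4 (1)(2) (p. 273), §17.13 (pp. 279–280), 14.9 (p. 239); [GreenbergLNM1716] Thm. 1.14 (p. 68); [Greenberg1989]
pp. 101–102; [MazurTateTeitelbaum1986Invent] §I.17; [Washington1997] §13.2.
-/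

noncomputable section

open scoped Classical MatrixGroups ModularForm
open Field CongruenceSubgroup
open Literature.NumberTheory.EllipticCurves Literature.NumberTheory.EllipticCurves.ModularForms
  Literature.NumberTheory.EllipticCurves.IwasawaAlgebra Literature.NumberTheory.EllipticCurves.Module

namespace Literature.NumberTheory.EllipticCurves.Kato2004

open Module

section Consequences

variable {W : WeierstrassCurve ℚ} [W.IsElliptic] {p : ℕ} [Fact p.Prime]
  [ContinuousSMul ℤ_[p] (W.tateModule p)] {θ : IwasawaAlgebra p} {L : PowerSeries ℚ_[p]}
  {κ : ZpExtension ℚ p} {γ : absoluteGaloisGroup ℚ}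
  {I : IwasawaH1Data W p κ γ} {D : W.SelmerDualData κ γ⁻¹}

/-- `2·θ·p^a`, as an element of `Λ = ℤ_p⟦T⟧`, is non-zero and lies in no height-one prime `𝔭 ∌ p` with
`θ ∉ 𝔭` (any prime `p`): the joint defect constant (Poitou–Tate `p^a`, descent `2`, the exceptional `θ`).
[cite: Kato2004Asterisque, (12.1.4) (p. 220), §17.13 (17.13.1) (p. 279), Thm. 12.5 (3) with (12.5.1) (p. 222), Thm. 17.4 (2) (p. 273; height-one primes not containing p)] -/
theorem two_mul_mul_natCast_pow_ne_zero_and_not_mem (hθ : θ ≠ 0) (a : ℕ) :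
    ((2 : IwasawaAlgebra p) * θ * (p : IwasawaAlgebra p) ^ a ≠ 0) ∧
      ∀ 𝔭 : PrimeSpectrum (IwasawaAlgebra p), 𝔭.asIdeal.height = 1 →
        PowerSeries.C (p : ℤ_[p]) ∉ 𝔭.asIdeal → θ ∉ 𝔭.asIdeal →
          (2 : IwasawaAlgebra p) * θ * (p : IwasawaAlgebra p) ^ a ∉ 𝔭.asIdeal := by
  obtain ⟨h2, h2'⟩ := two_mul_natCast_pow_ne_zero_and_not_mem p a
  have hrw : (2 : IwasawaAlgebra p) * θ * (p : IwasawaAlgebra p) ^ a =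
      θ * (2 * (p : IwasawaAlgebra p) ^ a) := by ring
  rw [hrw]
  refine ⟨mul_ne_zero hθ h2, fun 𝔭 h1 hp𝔭 hθ𝔭 hmem => ?_⟩
  rcases 𝔭.isPrime.mem_or_mem hmem with h | h
  · exact hθ𝔭 h
  · exact h2' 𝔭 h1 hp𝔭 h

/-- **`X(W/ℚ_∞)` is `Λ`-torsion** from an odd split-twist descent package with `θ ≠ 0`, `L ≠ 0` (Thm. 17.4 (1)
shape; the skeleton `isTorsion_of_skeleton_kerUpTo` with defect `2θ·p^a`).
[cite: Kato2004Asterisque, Thm. 17.4 (1) (p. 273) and §17.13 (pp. 279–280)] -/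
theorem SplitTwistDivisibilityInputsDescent.isTorsion_X
    (K : SplitTwistDivisibilityInputsDescent W p θ L κ γ I D) (hθ : θ ≠ 0) (hL : L ≠ 0) :
    Module.IsTorsion (IwasawaAlgebra p) D.X := by
  obtain ⟨hc0, -⟩ := two_mul_mul_natCast_pow_ne_zero_and_not_mem (p := p) hθ K.a
  obtain ⟨hGZ, hG⟩ := K.G_mem_and_ne_zero hθ hL
  obtain ⟨z, -, hz⟩ := Submodule.mem_map.mp hGZ
  simp only [LinearMap.coe_comp, Function.comp_apply] at hz
  have hcol : ∀ y : K.P, K.col y = 0 →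
      ((2 : IwasawaAlgebra p) * θ * (p : IwasawaAlgebra p) ^ K.a) • y = 0 := fun y hy => by
    rw [mul_comm, mul_smul, K.col_ker y hy, smul_zero]
  have hPX : ∀ h : I.H,
      ((2 : IwasawaAlgebra p) * θ * (p : IwasawaAlgebra p) ^ K.a) • K.toX (K.loc h) = 0 := fun h => by
    rw [mul_smul, K.upTo_P h, smul_zero]
  have hXH : ∀ x : D.X, K.δ x = 0 →
      ((2 : IwasawaAlgebra p) * θ * (p : IwasawaAlgebra p) ^ K.a) • x ∈ LinearMap.range K.toX :=
    fun x hx => by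
      rw [mul_smul]
      exact Submodule.smul_mem _ _ (K.upTo_X x hx)
  exact isTorsion_of_skeleton_kerUpTo hc0 K.loc K.toX K.δ hPX hXH K.col hcol hG hz K.isTorsion_H2

/-- **`ℓ_𝔮(X) ≤ ℓ_𝔮(Λ/(L̃))` OFF the exceptional element `θ`.** Package
`K : SplitTwistDivisibilityInputsDescent W p θ L κ γ I D` (so `ι K.G = pⁿ·ι(θ)·L`), an integral `L̃ ≠ 0` with
`ι L̃ = p^m·L`, Kato's Thm. 12.4 (2) (`thm12_4`) for the binders of `I.H`; then at every height-one `𝔮 ∌ p` with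
`θ ∉ 𝔮`: `ℓ_𝔮(D.X) ≤ ℓ_𝔮(Λ/(L̃))`. Proof: `Kato2004.lengthAt_add_le_of_skeleton_exceptional_kerUpTo` PRIME BY PRIME
with defect `c = 2θ·p^a ∉ 𝔮` (with `J = ⊤`: the local term of Thm. 12.5 (3) cancels against `upTo_H2loc`)
gives `ℓ_𝔮(X) ≤ ℓ_𝔮(Λ/(G))`, and `p^m·G = pⁿ·θ·L̃` in `Λ` with `ℓ_𝔮(Λ/(p^k)) = ℓ_𝔮(Λ/(θ)) = 0`. Odd-branch twin of
`MultDivisibilityInputsContra.lengthAt_X_le_off_factor`.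
[cite: Kato2004Asterisque, Thm. 12.4 (2) (p. 221), Thm. 12.5 (3) (p. 222), Conj. 17.6 (p. 274), §17.13 (pp. 279–280), 14.9 (p. 239)] -/
theorem SplitTwistDivisibilityInputsDescent.lengthAt_X_le_off_theta (h12 : thm12_4) (hκ : κ.IsCyclotomic)
    (hγ : κ.IsTopGenerator γ) (K : SplitTwistDivisibilityInputsDescent W p θ L κ γ I D)
    {Lt : IwasawaAlgebra p} {m : ℕ}
    (hLt : iwasawaToPowerSeries p Lt = PowerSeries.C ((p : ℚ_[p]) ^ m) * L) (hLt0 : Lt ≠ 0)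
    (𝔮 : PrimeSpectrum (IwasawaAlgebra p)) (h𝔮 : 𝔮.asIdeal.height = 1)
    (hp𝔮 : PowerSeries.C (p : ℤ_[p]) ∉ 𝔮.asIdeal) (hθ𝔮 : θ ∉ 𝔮.asIdeal) :
    lengthAt (IwasawaAlgebra p) D.X 𝔮 ≤
      lengthAt (IwasawaAlgebra p) (IwasawaAlgebra p ⧸ Ideal.span {Lt}) 𝔮 := by
  obtain ⟨htf, hrank⟩ := h12.isTorsionFree_and_rank_le_one W p hκ hγ I
  haveI := htf
  have hθ0 : θ ≠ 0 := fun h => hθ𝔮 (h ▸ 𝔮.asIdeal.zero_mem)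
  obtain ⟨-, hc⟩ := two_mul_mul_natCast_pow_ne_zero_and_not_mem (p := p) hθ0 K.a
  have hL0 : L ≠ 0 := by
    intro h0
    apply hLt0
    apply iwasawaToPowerSeries_injective p
    rw [hLt, h0, mul_zero, map_zero]
  obtain ⟨hGZ, hG⟩ := K.G_mem_and_ne_zero hθ0 hL0
  have hfin : lengthAt (IwasawaAlgebra p) K.H2loc 𝔮 ≠ ⊤ :=
    ne_top_of_le_ne_top (by simp) (K.lengthAt_H2loc_le_one 𝔮 h𝔮 hp𝔮)
  -- the four «upto» clauses and the Coleman kernel with the joint constant `c = 2θ·p^a`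
  have hcol : ∀ y : K.P, K.col y = 0 →
      ((2 : IwasawaAlgebra p) * θ * (p : IwasawaAlgebra p) ^ K.a) • y = 0 := fun y hy => by
    rw [mul_comm, mul_smul, K.col_ker y hy, smul_zero]
  have hPX : ∀ h : I.H,
      ((2 : IwasawaAlgebra p) * θ * (p : IwasawaAlgebra p) ^ K.a) • K.toX (K.loc h) = 0 := fun h => by
    rw [mul_smul, K.upTo_P h, smul_zero]
  have hXH : ∀ x : D.X, K.δ x = 0 →
      ((2 : IwasawaAlgebra p) * θ * (p : IwasawaAlgebra p) ^ K.a) • x ∈ LinearMap.range K.toX :=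
    fun x hx => by
      rw [mul_smul]
      exact Submodule.smul_mem _ _ (K.upTo_X x hx)
  have hH2 : ∀ x : D.X,
      ((2 : IwasawaAlgebra p) * θ * (p : IwasawaAlgebra p) ^ K.a) • K.ε (K.δ x) = 0 := fun x => by
    rw [mul_smul, K.upTo_H2 x, smul_zero]
  have hcoker : ∀ y : K.H2loc,
      ((2 : IwasawaAlgebra p) * θ * (p : IwasawaAlgebra p) ^ K.a) • y ∈ LinearMap.range K.ε :=
    fun y => by
      rw [mul_smul]
      exact Submodule.smul_mem _ _ (K.upTo_H2loc y)
  -- the §17.13 bound at `𝔮`, local term absorbed: `ℓ(X) + ℓ(Λ/⊤) ≤ ℓ(Λ/(G))`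
  have hA := lengthAt_add_le_of_skeleton_exceptional_kerUpTo hrank K.loc K.toX K.δ K.ε hPX hXH hH2
    hcoker K.col hcol (J := ⊤) (fun _ => Submodule.mem_top) K.Z hG hGZ 𝔮 (hc 𝔮 h𝔮 hp𝔮 hθ𝔮) hfin
    (K.es_bound 𝔮 h𝔮 hp𝔮)
  have hXG : lengthAt (IwasawaAlgebra p) D.X 𝔮 ≤
      lengthAt (IwasawaAlgebra p) (IwasawaAlgebra p ⧸ Ideal.span {K.G}) 𝔮 :=
    le_trans le_self_add hA
  -- `p^m · G = p^n · θ · L̃` in `Λ`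
  have key : PowerSeries.C ((p : ℤ_[p]) ^ m) * K.G =
      PowerSeries.C ((p : ℤ_[p]) ^ K.n) * (θ * Lt) := by
    apply iwasawaToPowerSeries_injective p
    rw [map_mul, map_mul, map_mul, K.ιG_eq, hLt]
    simp only [iwasawaToPowerSeries, map_pow, map_natCast]
    ring
  have hLen : lengthAt (IwasawaAlgebra p) (IwasawaAlgebra p ⧸ Ideal.span {K.G}) 𝔮 =
      lengthAt (IwasawaAlgebra p) (IwasawaAlgebra p ⧸ Ideal.span {Lt}) 𝔮 := by
    rw [← lengthAt_quotient_span_C_pow_mul (m := m) K.G 𝔮 h𝔮 hp𝔮, key,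
      lengthAt_quotient_span_C_pow_mul (m := K.n) (θ * Lt) 𝔮 h𝔮 hp𝔮,
      lengthAt_quotient_span_singleton_mul Lt hθ0 𝔮,
      lengthAt_quotient_eq_zero_of_not_le (by rwa [Ideal.span_singleton_le_iff_mem]), zero_add]
  exact hLen ▸ hXG

/-- **`ℓ_{𝔮₀}(X) ≤ ℓ_{𝔮₀}(Λ/(L̃))` AT the exceptional prime, by TRANSPORT.** Same package data; `𝔮₀ ∌ p` of height
one such that `θ ∉ ι𝔮₀` (e.g. `𝔮₀ = (θ)`: `ι(5T + 4) ≐ T − 4`), and the two symmetries `ι(char X) = char X`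
(Greenberg LNM 1716 Thm. 1.14, ideal form — for the additive curve obtained from the theorem over `ℚ(i)` and over
`ℚ` for the twist; tree facts, glued in the cell's door files) and `(ι L̃) = (L̃)` (functional equation of the odd
branch — a tree THEOREM at `2`). Then Conj. 17.6's inequality holds at `𝔮₀` SHARP (the package alone gives it only
up to the colength `1` of `col⁻` there). Odd-branch twin of
`MultDivisibilityInputsContra.lengthAt_X_le_at_factor_of_transport`; finite generation of `D.X` is an instance
hypothesis (key `γ⁻¹`).
[cite: Kato2004Asterisque, Thm. 12.5 (3) and (12.5.1) (p. 222), Conj. 17.6 (p. 274), §17.13 (pp. 279–280)]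
[cite: GreenbergLNM1716, Thm. 1.14 (p. 68)] [cite: Greenberg1989, pp. 101–102 (S^ι)]
[cite: MazurTateTeitelbaum1986Invent, §I.17 (functional equation)] -/
theorem SplitTwistDivisibilityInputsDescent.lengthAt_X_le_at_theta_of_transport
    [Module.Finite (IwasawaAlgebra p) D.X] (h12 : thm12_4)
    (hκ : κ.IsCyclotomic) (hγ : κ.IsTopGenerator γ) (K : SplitTwistDivisibilityInputsDescent W p θ L κ γ I D)
    {Lt : IwasawaAlgebra p} {m : ℕ}
    (hLt : iwasawaToPowerSeries p Lt = PowerSeries.C ((p : ℚ_[p]) ^ m) * L) (hLt0 : Lt ≠ 0)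
    (𝔮₀ : PrimeSpectrum (IwasawaAlgebra p)) (h𝔮₀ : 𝔮₀.asIdeal.height = 1)
    (hp𝔮₀ : PowerSeries.C (p : ℤ_[p]) ∉ 𝔮₀.asIdeal)
    (hθ : θ ∉ (PrimeSpectrum.comap (invol p).toRingHom 𝔮₀).asIdeal)
    (hXι : (charIdeal (IwasawaAlgebra p) D.X).map (invol p).toRingHom =
      charIdeal (IwasawaAlgebra p) D.X)
    (hLtι : (Ideal.span {Lt}).map (invol p).toRingHom = Ideal.span {Lt}) :
    lengthAt (IwasawaAlgebra p) D.X 𝔮₀ ≤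
      lengthAt (IwasawaAlgebra p) (IwasawaAlgebra p ⧸ Ideal.span {Lt}) 𝔮₀ := by
  set 𝔮' := PrimeSpectrum.comap (invol p).toRingHom 𝔮₀ with h𝔮'def
  have h𝔮' : 𝔮'.asIdeal.height = 1 := by rw [h𝔮'def, height_comap_invol]; exact h𝔮₀
  have hp𝔮' : PowerSeries.C (p : ℤ_[p]) ∉ 𝔮'.asIdeal := by
    intro h
    apply hp𝔮₀
    rw [h𝔮'def, PrimeSpectrum.comap_asIdeal, Ideal.mem_comap] at h
    change invol p (PowerSeries.C (p : ℤ_[p])) ∈ 𝔮₀.asIdeal at h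
    rwa [invol_C] at h
  have hA := K.lengthAt_X_le_off_theta h12 hκ hγ hLt hLt0 𝔮' h𝔮' hp𝔮' hθ
  -- `X` is torsion (from the package), so Greenberg's symmetry can be read prime by prime
  have hθ0 : θ ≠ 0 := fun h => hθ (h ▸ 𝔮'.asIdeal.zero_mem)
  have hL0 : L ≠ 0 := by
    intro h0
    apply hLt0
    apply iwasawaToPowerSeries_injective p
    rw [hLt, h0, mul_zero, map_zero]
  have hXtors : Module.IsTorsion (IwasawaAlgebra p) D.X := K.isTorsion_X hθ0 hL0
  rw [lengthAt_eq_comap_invol_of_map_invol_charIdeal_eq hXtors hXι 𝔮₀ h𝔮₀,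
    lengthAt_quotient_span_eq_comap_invol_of_map_invol_span_eq hLtι 𝔮₀]
  exact hA

/-- **`ℓ_{𝔮₀}(X) ≤ ℓ_{𝔮₀}(Λ/(L̃))` AT the exceptional prime, LENGTH form of the transport hypothesis**: as
`lengthAt_X_le_at_theta_of_transport` with `ℓ_{𝔮₀}(D.X) = ℓ_{ι𝔮₀}(D.X)` instead of the ideal form (finite
generation of `D.X` not needed). Odd-branch twin of `MultDivisibilityInputsContra.lengthAt_X_le_at_factor_of_lengthAt_symm`.
[cite: Kato2004Asterisque, Thm. 12.5 (3) and (12.5.1) (p. 222), Conj. 17.6 (p. 274), §17.13 (pp. 279–280)]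
[cite: GreenbergLNM1716, Thm. 1.14 (p. 68)] [cite: MazurTateTeitelbaum1986Invent, §I.17] -/
theorem SplitTwistDivisibilityInputsDescent.lengthAt_X_le_at_theta_of_lengthAt_symm (h12 : thm12_4)
    (hκ : κ.IsCyclotomic) (hγ : κ.IsTopGenerator γ) (K : SplitTwistDivisibilityInputsDescent W p θ L κ γ I D)
    {Lt : IwasawaAlgebra p} {m : ℕ}
    (hLt : iwasawaToPowerSeries p Lt = PowerSeries.C ((p : ℚ_[p]) ^ m) * L) (hLt0 : Lt ≠ 0)
    (𝔮₀ : PrimeSpectrum (IwasawaAlgebra p)) (h𝔮₀ : 𝔮₀.asIdeal.height = 1)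
    (hp𝔮₀ : PowerSeries.C (p : ℤ_[p]) ∉ 𝔮₀.asIdeal)
    (hθ : θ ∉ (PrimeSpectrum.comap (invol p).toRingHom 𝔮₀).asIdeal)
    (hXsym : lengthAt (IwasawaAlgebra p) D.X 𝔮₀ =
      lengthAt (IwasawaAlgebra p) D.X (PrimeSpectrum.comap (invol p).toRingHom 𝔮₀))
    (hLtι : (Ideal.span {Lt}).map (invol p).toRingHom = Ideal.span {Lt}) :
    lengthAt (IwasawaAlgebra p) D.X 𝔮₀ ≤
      lengthAt (IwasawaAlgebra p) (IwasawaAlgebra p ⧸ Ideal.span {Lt}) 𝔮₀ := by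
  set 𝔮' := PrimeSpectrum.comap (invol p).toRingHom 𝔮₀ with h𝔮'def
  have h𝔮' : 𝔮'.asIdeal.height = 1 := by rw [h𝔮'def, height_comap_invol]; exact h𝔮₀
  have hp𝔮' : PowerSeries.C (p : ℤ_[p]) ∉ 𝔮'.asIdeal := by
    intro h
    apply hp𝔮₀
    rw [h𝔮'def, PrimeSpectrum.comap_asIdeal, Ideal.mem_comap] at h
    change invol p (PowerSeries.C (p : ℤ_[p])) ∈ 𝔮₀.asIdeal at h
    rwa [invol_C] at h
  have hA := K.lengthAt_X_le_off_theta h12 hκ hγ hLt hLt0 𝔮' h𝔮' hp𝔮' hθ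
  rw [hXsym, lengthAt_quotient_span_eq_comap_invol_of_map_invol_span_eq hLtι 𝔮₀]
  exact hA

/-- **From the three facts at `p = 2` (no Summits-side input):** `nonempty_iwasawaH1Data`, `thm12_4` (file
`IwasawaCohomology`) and `exists_splitTwistDivisibilityInputsDescent_negOne_two` give, for `W` additive with
`W^{(−1)}` split multiplicative at `2`, `f′` its twist's newform, `γ` with `κ_cyc(γ) = 5`, any integral multiple
`L̃ = 2^m·L⁻ ≠ 0` of the odd branch and any key-`γ⁻¹` datum `D`: `ℓ_𝔮(X(W/ℚ_∞)) ≤ ℓ_𝔮(Λ/(L̃))` at every height-one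
`𝔮 ∌ 2` not containing `5T + 4`. (At `(5T + 4)`: `lengthAt_X_le_at_theta_of_transport`.)
[cite: Kato2004Asterisque, Thm. 12.5 (3) with (12.5.1) (p. 222), Thm. 17.4 (1)(2) (p. 273; shape) and §17.13 (pp. 279–280)] -/
theorem lengthAt_X_le_off_theta_of_splitTwistDescentFacts_two {W : WeierstrassCurve ℚ} [W.IsElliptic]
    [W.IsGloballyMinimal] [ContinuousSMul ℤ_[2] (W.tateModule 2)] {κ : ZpExtension ℚ 2}
    {γ : absoluteGaloisGroup ℚ} (hne : nonempty_iwasawaH1Data) (h12 : thm12_4)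
    (hin : exists_splitTwistDivisibilityInputsDescent_negOne_two)
    (hsp : (W.quadraticTwist (-1)).HasSplitMultiplicativeReductionAtPrime 2) (hκ : κ.IsCyclotomic)
    (hγ : κ.IsTopGenerator γ)
    (hγ5 : ((GaloisRepresentations.GaloisRep.cyclotomicCharacter ℚ 2 γ : ℤ_[2]ˣ) : ℤ_[2]) =
      (cyclotomicGenerator 2 : ℤ_[2]))
    {N : ℕ} [NeZero N] {f : CuspForm (Gamma0 N) 2} (hf : IsNewformOf (W.quadraticTwist (-1)) f)
    (D : W.SelmerDualData κ γ⁻¹) {Lt : IwasawaAlgebra 2} {m : ℕ}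
    (hLt : iwasawaToPowerSeries 2 Lt =
      PowerSeries.C ((2 : ℚ_[2]) ^ m) * padicLFunctionMinusBranchMult f (1 : ℚ_[2]) 1) (hLt0 : Lt ≠ 0)
    (𝔮 : PrimeSpectrum (IwasawaAlgebra 2)) (h𝔮 : 𝔮.asIdeal.height = 1)
    (hp𝔮 : PowerSeries.C (2 : ℤ_[2]) ∉ 𝔮.asIdeal)
    (hθ𝔮 : (PowerSeries.C 5 * PowerSeries.X + PowerSeries.C 4 : IwasawaAlgebra 2) ∉ 𝔮.asIdeal) :
    lengthAt (IwasawaAlgebra 2) D.X 𝔮 ≤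
      lengthAt (IwasawaAlgebra 2) (IwasawaAlgebra 2 ⧸ Ideal.span {Lt}) 𝔮 := by
  obtain ⟨I⟩ := hne W 2 κ γ hκ hγ
  obtain ⟨K⟩ := hin W f κ γ hsp hκ hγ hγ5 hf I D
  have hp2 : ((2 : ℕ) : ℚ_[2]) = (2 : ℚ_[2]) := by norm_num
  have hLt' : iwasawaToPowerSeries 2 Lt =
      PowerSeries.C (((2 : ℕ) : ℚ_[2]) ^ m) * padicLFunctionMinusBranchMult f (1 : ℚ_[2]) 1 := by
    rw [hp2]; exact hLt
  have hp𝔮' : PowerSeries.C ((2 : ℕ) : ℤ_[2]) ∉ 𝔮.asIdeal := by exact_mod_cast hp𝔮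
  exact K.lengthAt_X_le_off_theta h12 hκ hγ hLt' hLt0 𝔮 h𝔮 hp𝔮' hθ𝔮

end Consequences

end Literature.NumberTheory.EllipticCurves.Kato2004

end
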